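import Summits.Parity.GeneralizedHardyLittlewood.Theorems.Dhl42Density

/-!
# DHL[42,2] certificate — Lemma 6.1(a), part 2: `∫_{B·R_{n+1}} Π_j f_j(t_j) φ(Σ_j t_j) dt = ∫_0^B (dens f)(v) φ(v) dv`

**`integral_simplex_eq_dens`** (Lemma 6.1(a) in density form) for every test function `φ`, by
induction on `n` with the peeling step of `Dhl42Density` — the one-variable step is exactly the
convolution identity `EP.eval_conv`; invariance of simplex integrals under permutations of the
coordinates (`integral_comp_perm`, `simplexIntegrand_comp_perm`, `integral_simplexIntegrand_perm`:
Lebesgue measure on `ℝ^k` is permutation invariant and the simplex is symmetric); and `dens` of a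
constant family = the iterated convolution `EP.convIter` (`dens_const`, `dens_cons`).

Origin: `Dhl42/ClosedForm/Density.lean` of the DHL[42,2] certificate package (pub-dhl42 bundle,
archive blob `18cce9e3`; sha256[:16] of the file `057bcc044d8a75b1`; paper snapshot =
`paper/main.tex` v1), lines :296–:384; statements and proofs unchanged except: namespace
`Dhl42.ClosedForm` → `Summit.Parity.GeneralizedHardyLittlewood.Theorems.Dhl42.ClosedForm`,
`open TpY4Dhl42` dropped (the certificate's Part 1–7 declarations, migrated to
`Summit.Parity.GeneralizedHardyLittlewood.Theorems.Dhl42` in batches B2/B3, are in scope in the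
sub-namespace), `Dhl42.ExpPoly` → the tree's `Literature.Analysis.ValidatedNumerics.ExpPoly`
(`ExpPoly/*.lean`, batch B1), the package's `simplexSet n B` replaced by the tree's definitionally
equal `Literature.NumberTheory.Sieve.scaledSimplex n B` (also inside the names of the B2/B3 lemmas
used), docstrings added where missing. Package-internal references in the verbatim docstrings
(`Density.lean`, `Setup.lean`, `KernelBridge.lean`, `MainI.…`) refer to that package (paper Appendix
B).

Declarations (6): `integral_simplex_eq_dens`, `integral_comp_perm`, `simplexIntegrand_comp_perm`,
`integral_simplexIntegrand_perm`, `dens_const`, `dens_cons`.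
-/

open MeasureTheory Set Filter Real intervalIntegral
open Literature.Analysis.ValidatedNumerics.ExpPoly
open Literature.NumberTheory.Sieve (scaledSimplex)

namespace Summit.Parity.GeneralizedHardyLittlewood.Theorems.Dhl42.ClosedForm

noncomputable section

/-! ### The theorem -/

/-- **Lemma 6.1(a)** (density form).  For one-variable exponential sums `f_j` and a bounded
measurable `φ`, `∫_{B·R_{n+1}} Π_j f_j(t_j) φ(Σ_j t_j) dt = ∫_0^B (dens f)(v) φ(v) dv`. -/
theorem integral_simplex_eq_dens : ∀ (n : ℕ) (f : Fin (n + 1) → ES) (B : ℝ), 0 ≤ B →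
    ∀ (φ : ℝ → ℝ), TestFn B φ →
      ∫ t, simplexIntegrand n f B φ t = ∫ v in (0 : ℝ)..B, EP.eval (dens n f) v * φ v
  | 0, f, B, hB, φ, _ => by
      rw [integral_simplex_one f B hB φ]
      simp only [dens, ES.eval_toEP]
  | n + 1, f, B, hB, φ, hφ => by
      -- (1) Fubini: peel coordinate 0
      have hint := integrable_simplexIntegrand (n + 1) f B hφ
      rw [integral_eq_integral_cons, volume_prod_eq,
        MeasureTheory.integral_prod _ (by rw [← volume_prod_eq]; exact integrable_cons hint)]
      -- (2) the inner integral, by the induction hypothesis on the tail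
      have IH : ∀ s ∈ Icc (0 : ℝ) B,
          ∫ t', simplexIntegrand n (Fin.tail f) (B - s) (fun v => φ (s + v)) t' =
            ∫ v in (0 : ℝ)..(B - s), EP.eval (dens n (Fin.tail f)) v * φ (s + v) :=
        fun s hs => integral_simplex_eq_dens n (Fin.tail f) (B - s) (by linarith [hs.2]) _
          (hφ.shift hs.1)
      have hinner : (fun s : ℝ => ∫ t', simplexIntegrand (n + 1) f B φ (Fin.cons s t')) =
          (Icc (0 : ℝ) B).indicator (fun s => ES.eval (f 0) s *
            ∫ v in (0 : ℝ)..(B - s), EP.eval (dens n (Fin.tail f)) v * φ (s + v)) :=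
        funext (integral_simplexIntegrand_cons f B φ IH)
      have hinner' : (fun p : ℝ × (Fin (n + 1) → ℝ) => simplexIntegrand (n + 1) f B φ (Fin.cons p.1 p.2)) =
          fun p => simplexIntegrand (n + 1) f B φ (Fin.cons p.1 p.2) := rfl
      show ∫ s, ∫ t', simplexIntegrand (n + 1) f B φ (Fin.cons s t') = _
      rw [hinner, MeasureTheory.integral_indicator measurableSet_Icc, integral_Icc_eq_integral_Ioc,
        ← integral_of_le hB]
      -- (3) translate v ↦ s + v, then swap on the triangle
      simp_rw [pairing_translate]
      rw [triangle_swap (ES.continuous_eval (f 0)) (EP.continuous_eval _) hB hφ]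
      -- (4) the inner integral is the convolution
      apply intervalIntegral.integral_congr
      intro u _
      simp only [dens]
      rw [conv_reflect, ← EP.eval_conv, mul_comm]

/-! ### Permutations of the coordinates -/

/-- Lebesgue measure on `ℝ^k` is invariant under permutations of the coordinates:
`∫ Ψ(t ∘ σ) dt = ∫ Ψ(t) dt`. -/
theorem integral_comp_perm {k : ℕ} (σ : Equiv.Perm (Fin k)) (Ψ : (Fin k → ℝ) → ℝ) :
    ∫ t, Ψ (t ∘ ⇑σ) = ∫ t, Ψ t := by
  have h := (volume_measurePreserving_piCongrLeft (fun _ : Fin k => ℝ) σ.symm).integral_comp'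
    (g := Ψ)
  rw [← h]
  congr 1
  funext t
  congr 1
  funext b
  have happ := Equiv.piCongrLeft_apply_apply (P := fun _ : Fin k => ℝ) (e := σ.symm) t (σ b)
  rw [Equiv.symm_apply_apply] at happ
  rw [MeasurableEquiv.coe_piCongrLeft, Function.comp_apply, happ]

/-- Permuting the coordinates of the argument of a simplex integrand is the same as permuting the
factor family: `Φ_f(t ∘ σ) = Φ_{f ∘ σ⁻¹}(t)` (the simplex and `Σ_j t_j` are symmetric). -/
theorem simplexIntegrand_comp_perm {n : ℕ} (σ : Equiv.Perm (Fin (n + 1))) (f : Fin (n + 1) → ES)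
    (B : ℝ) (φ : ℝ → ℝ) (t : Fin (n + 1) → ℝ) :
    simplexIntegrand n f B φ (t ∘ ⇑σ) = simplexIntegrand n (f ∘ ⇑σ.symm) B φ t := by
  unfold simplexIntegrand
  have hmem := comp_perm_mem_scaledSimplex_iff σ t B
  by_cases ht : t ∈ scaledSimplex (n + 1) B
  · rw [indicator_of_mem (hmem.2 ht), indicator_of_mem ht]
    have hsum : ∑ j, (t ∘ ⇑σ) j = ∑ j, t j := Equiv.sum_comp σ t
    have hprod : ∏ j, ES.eval (f j) ((t ∘ ⇑σ) j) = ∏ j, ES.eval ((f ∘ ⇑σ.symm) j) (t j) := by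
      rw [← Equiv.prod_comp σ (fun i => ES.eval ((f ∘ ⇑σ.symm) i) (t i))]
      simp
    rw [hsum, hprod]
  · rw [indicator_of_notMem (fun h => ht (hmem.1 h)), indicator_of_notMem ht]

/-- The simplex integral depends on the factors only up to a permutation of the coordinates. -/
theorem integral_simplexIntegrand_perm {n : ℕ} (σ : Equiv.Perm (Fin (n + 1))) (f : Fin (n + 1) → ES)
    (B : ℝ) (φ : ℝ → ℝ) :
    ∫ t, simplexIntegrand n (f ∘ ⇑σ) B φ t = ∫ t, simplexIntegrand n f B φ t := by
  have h := integral_comp_perm σ.symm (simplexIntegrand n f B φ)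
  simp_rw [simplexIntegrand_comp_perm, Equiv.symm_symm] at h
  exact h

/-! ### Constant factors: `dens` is the iterated convolution -/

/-- For a constant family `f_j = g` the density `dens` is the iterated convolution
`EP.convIter g n g` = `g^{⋆(n+1)}`. -/
theorem dens_const (g : ES) : ∀ n : ℕ, dens n (fun _ : Fin (n + 1) => g) = EP.convIter g n (ES.toEP g)
  | 0 => rfl
  | n + 1 => by
      rw [EP.convIter_succ']
      show EP.conv g (dens n (Fin.tail fun _ : Fin (n + 2) => g)) = _
      rw [show (Fin.tail fun _ : Fin (n + 2) => g) = fun _ : Fin (n + 1) => g from rfl, dens_const g n]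

/-- Peeling rule: `dens (g, f_0, …, f_n) = g ⋆ dens (f_0, …, f_n)`. -/
theorem dens_cons {n : ℕ} (g : ES) (f : Fin (n + 1) → ES) :
    dens (n + 1) (Fin.cons g f) = EP.conv g (dens n f) := by
  simp only [dens, Fin.cons_zero, Fin.tail_cons]

end

end Summit.Parity.GeneralizedHardyLittlewood.Theorems.Dhl42.ClosedForm
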